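import Summits.BirchSwinnertonDyer.BirchSwinnertonDyer.Theorems.QuadraticBranchSignedControlPlusLowerInclusionUnitRows
import Literature.NumberTheory.EllipticCurves.Kobayashi2003.PlusEtaCharIdealDivisibility
import HarnessLib

/-!
# Route `QuadraticBranchSignedControl` (rung K8, cell `bsd-potss`), item `PlusKatoDivisibilityBranch`
# (stmt-BirchSwinnertonDyer-19241, the Kato half (RK⁺) of the seam re-cut of (C1_η)): the route decl
# FROM THREE NAMED LITERATURE FACTS — Kobayashi 2003 Thm. 4.1 first display at `η`
# (`Kobayashi2003.thm41_plusEtaCharIdeal_dvd`), Thm. 2.2 at `η`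
# (`Kobayashi2003.thm22_etaSignedSelmerDual_finite_torsion`), Thm. 1.2
# (`Kobayashi2003.thm12_signedSelmerDual_finite_torsion`) — and the descent frame, DIRECTLY through the
# decomposition lemma

WHAT. Item 19241 carries the READING (RK⁺) `QuadraticBranchPlusKatoDivisibilityAt V p` (Thm. 2.2 + 4.1
at `η` in the `ℚ(√p*)`-subtower currency; flag `Kob03-Thm41-eta-quadratic-subtower` = the prime-to-`p`
descent). Since 2026-08-26 all its printed ingredients are NAMED FACTS of the Literature on the
promotion copy of Kobayashi's `η`-component object (`Kobayashi2003.EtaSignedSelmerDualData`,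
definitionally equal to the Summits original — a Summits datum re-packages field by field): Thm. 2.2
at `η` (cell `bsd-cm`), Thm. 4.1 FIRST display at `η` (this seat, p420549), Thm. 1.2 over `ℚ_∞`. This
file proves, with NO displayed reading: GRANTED those three facts (hypothesis position) and the
∀-form descent frame `hdec` (the cell's WANTED piece (i): for every admissible quadratic model a
`Γ`-equivariant `Φ : Sel⁺(V'/F_∞) ≃ Sel⁺(V/ℚ_∞) × Sel⁺(V/K₀ℚ_∞)^η`; displayed), the node (RK⁺) at every
pair and the route decl `PlusKatoDivisibilityBranch`. PROOF: the decomposition lemma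
`exists_etaDatum_prod_linearEquiv_of_decomposition` (p420208: `DF.X ≃ₗ[Λ] D.X × Dη.X` for an
`η`-datum `Dη` at a generator `γ' ∈ Gal(ℚ̄/K₀)` with `κ γ' = κ γ`), `Char DF = Char D · Char Dη`
(multiplicativity; torsion of `D.X` by Thm. 1.2, of `Dη.X` by Thm. 2.2 at `η`), and Thm. 4.1 at `η`
for `Dη`: `pⁿ·Lη ∈ Char Dη` gives `(pⁿ)·Char D·(Lη) = Char D·((pⁿ Lη)) ⊆ Char D·Char Dη = Char DF`,
`n = 0` on the surjective rows. So 19241 is CITE-LEVEL modulo piece (i), every cite a named fact —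
the planner may re-type it like `PublishedInputKO13` (K8 rev 7). (Sibling `…PlusKatoDivisibilityOfEta.lean`,
p419912, proves the same through the displayed reading `hKη`; this file removes the display.)

HONEST FRAMING (cell `bsd-potss`, run/shared/lean/pub/bsd-potss/; FULL-BSD rank ≤ 1 programme): TOOL
THEOREMS ONLY — no definition, no named fact minted here, no `sorry`, axioms standard. CONDITIONAL on
three named Literature facts and on the displayed frame `hdec`; the item / route are NOT closed;
nothing is booked; `BSD(W, p)` is claimed for no pair; this is not "finishing BSD". Seat
`bsd-potss-k8q-c2` (prover), g0; `--supports stmt-BirchSwinnertonDyer-19241`.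

References: [Kobayashi2003] Thm. 1.2 (p. 2), Thm. 2.2 (p. 5), Thm. 4.1 (p. 8), §3 (p. 5), §4 (p. 8);
[GreenbergLNM1716] §1 (p. 60), §3; [Washington1997] §13.2.
-/

set_option autoImplicit false
set_option linter.dupNamespace false

noncomputable section

open scoped Classical

open CongruenceSubgroup Field WeierstrassCurve
open Literature.NumberTheory.EllipticCurves
open Literature.NumberTheory.EllipticCurves.ModularForms
open Literature.NumberTheory.GaloisRepresentations
open Summit.BirchSwinnertonDyer.Rank1Residual.Additive
open Summit.BirchSwinnertonDyer.Rank1Residual.Additive.SignedTwist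
open Summit.BirchSwinnertonDyer.BirchSwinnertonDyer.Theses.QuadraticBranchSignedControl

namespace Summit.BirchSwinnertonDyer.BirchSwinnertonDyer.Theorems

/-- **(RK⁺) AT A PAIR from the three NAMED facts and the frame** (abstract cyclotomic model `K₀`,
character `ηq` trivial on `Gal(ℚ̄/K₀)` and non-trivial — the quadratic character): `h41` =
`Kobayashi2003.thm41_plusEtaCharIdeal_dvd` (Thm. 4.1 first display at `η`), `h22` =
`Kobayashi2003.thm22_etaSignedSelmerDual_finite_torsion` (Thm. 2.2 at `η`), `h12` =
`Kobayashi2003.thm12_signedSelmerDual_finite_torsion` (Thm. 1.2), all in hypothesis position; `hdec` =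
the ∀-form descent frame at `(V, p, K₀, ηq)` (WANTED; displayed). Conclusion:
`QuadraticBranchPlusKatoDivisibilityAt V p`. Proof: module docstring. CONDITIONAL; closes nothing.
[cite: Kobayashi2003, Thm. 1.2 (p. 2), Thm. 2.2 (p. 5), Thm. 4.1 (p. 8)]
[cite: Washington1997, §13.2 (characteristic ideals over Λ)] -/
theorem quadraticBranchPlusKatoDivisibilityAt_of_namedFacts_of_decomposition
    {V : WeierstrassCurve ℚ} [V.IsElliptic] [V.IsGloballyMinimal] {p : ℕ} [Fact p.Prime]
    (h41 : Kobayashi2003.thm41_plusEtaCharIdeal_dvd)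
    (h22 : Kobayashi2003.thm22_etaSignedSelmerDual_finite_torsion)
    (h12 : Kobayashi2003.thm12_signedSelmerDual_finite_torsion)
    (K₀ : Type) [Field K₀] [NumberField K₀] [IsCyclotomicExtension {p} ℚ K₀]
    [(galRange (K := ℚ) K₀).Normal] (ηq : absoluteGaloisGroup ℚ →* ℤˣ)
    (hηK : ∀ σ ∈ galRange (K := ℚ) K₀, ηq σ = 1) (hη1 : ηq ≠ 1)
    (hdec : ∀ (κ : ZpExtension ℚ p) (γ : absoluteGaloisGroup ℚ),
        κ.IsCyclotomic → κ.IsTopGenerator γ → γ ∈ galRange (K := ℚ) K₀ →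
        IsCyclotomicVariable p γ →
      ∀ (F : Type) [Field F] [NumberField F] (V' : WeierstrassCurve F) [V'.IsElliptic]
        (κF : ZpExtension F p) (γF : absoluteGaloisGroup F),
        Module.finrank ℚ F = 2 → (∃ θ : F, θ ^ 2 = algebraMap ℚ F ((-1) ^ (p / 2) * p)) →
        (∃ C : VariableChange F, C • V.baseChange F = V') →
        κF.IsCyclotomic → κF.IsTopGenerator γF →
        (∃ ζ : ℤ_[p]ˣ, IsOfFinOrder ζ ∧
          ((GaloisRep.cyclotomicCharacter F p γF * ζ : ℤ_[p]ˣ) : ℤ_[p]) =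
            (cyclotomicGenerator p : ℤ_[p])) →
      ∃ Φ : Kobayashi2003.signedSelmerInfty V' κF 1 ≃+
          Kobayashi2003.signedSelmerInfty V κ 1 × towerSignedSelmerInftyEta V κ K₀ ℚ_[p] ηq 1,
        ∀ s : Kobayashi2003.signedSelmerInfty V' κF 1,
          ((Φ ⟨V'.conjH1 p κF.kerSubgroup γF s,
              Kobayashi2003.conjH1_mem_signedSelmerInfty V' κF 1 γF s.2⟩).1 :
              V.subgroupH1 p κ.kerSubgroup) =
            V.conjH1 p κ.kerSubgroup γ (Φ s).1 ∧
          ((Φ ⟨V'.conjH1 p κF.kerSubgroup γF s,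
              Kobayashi2003.conjH1_mem_signedSelmerInfty V' κF 1 γF s.2⟩).2 :
              V.subgroupH1 p (towerTopSubgroup κ K₀)) =
            V.conjH1 p (towerTopSubgroup κ K₀) γ (Φ s).2) :
    QuadraticBranchPlusKatoDivisibilityAt V p := by
  intro F _ _ V' _ κ γ κF γF N _ f hp2 hgood hap hF hθ hC hκ hγ hγc hκF hγF hζ hf ϖ hϖ Lη hL D DF
  obtain ⟨γ', hγ'K, hγ', hγ'c, Dη, ⟨e⟩⟩ :=
    exists_etaDatum_prod_linearEquiv_of_decomposition K₀ ηq hdec F V' hF hθ hC hκ hγ hγc hκF hγF hζ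
      D DF
  -- Thm. 1.2 for `D`
  obtain ⟨hDfin, hDtor⟩ := h12 V p hp2 hgood hap κ γ hκ hγ 1 D
  -- Thm. 2.2 and Thm. 4.1 at `η` for `Dη`, through the Literature promotion copy of the `η`-object
  let Dη' : Literature.NumberTheory.EllipticCurves.Kobayashi2003.EtaSignedSelmerDualData
      V κ K₀ ℚ_[p] ηq γ' 1 :=
    { X := Dη.X
      conj_mem := Dη.conj_mem
      toDual := Dη.toDual
      bijective := Dη.bijective
      toDual_T_smul := Dη.toDual_T_smul
      toDual_C_smul := Dη.toDual_C_smul }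
  obtain ⟨hηfin, hηtor⟩ := h22 p K₀ ηq hηK V hp2 hgood hap κ γ' hκ hγ' hγ'K 1 Dη'
  obtain ⟨⟨n, hn⟩, hint⟩ :=
    h41 p K₀ ηq hηK hη1 V hp2 hgood hap hf ϖ hϖ Lη hL κ γ' hκ hγ' hγ'K hγ'c Dη' hηfin hηtor
  -- the product is finitely generated torsion with `Char = Char D.X · Char Dη.X`
  haveI : Module.Finite (IwasawaAlgebra p) D.X := hDfin
  haveI : Module.Finite (IwasawaAlgebra p) Dη.X := hηfin
  haveI hPfin : Module.Finite (IwasawaAlgebra p) (D.X × Dη.X) := inferInstance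
  have hPtor : Module.IsTorsion (IwasawaAlgebra p) (D.X × Dη.X) :=
    isTorsion_prod_of_isTorsion hDtor hηtor
  have hPchar : Module.charIdeal (IwasawaAlgebra p) (D.X × Dη.X) =
      Module.charIdeal (IwasawaAlgebra p) D.X * Module.charIdeal (IwasawaAlgebra p) Dη.X :=
    charIdeal_mul_of_shortExact_holds p (D.X × Dη.X) hPtor
      (LinearMap.inl (IwasawaAlgebra p) D.X Dη.X) (LinearMap.snd (IwasawaAlgebra p) D.X Dη.X)
      LinearMap.inl_injective LinearMap.snd_surjective .inl_snd
  -- transport to `DF`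
  have hfinF : Module.Finite (IwasawaAlgebra p) DF.X := Module.Finite.equiv e.symm
  have htorF : Module.IsTorsion (IwasawaAlgebra p) DF.X := by
    intro x
    obtain ⟨a, ha⟩ := @hPtor (e x)
    refine ⟨a, ?_⟩
    rw [Submonoid.smul_def] at ha ⊢
    have h := congrArg e.symm ha
    rwa [map_smul, map_zero, LinearEquiv.symm_apply_apply] at h
  have hcharF : DF.charIdeal = D.charIdeal * Dη.charIdeal := by
    change Module.charIdeal (IwasawaAlgebra p) DF.X =
      Module.charIdeal (IwasawaAlgebra p) D.X * Module.charIdeal (IwasawaAlgebra p) Dη.X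
    rw [Module.charIdeal_eq_of_linearEquiv e]
    exact hPchar
  refine ⟨hfinF, htorF, ⟨n, ?_⟩, fun hsurj => ?_⟩
  · rw [hcharF, mul_left_comm, Ideal.span_singleton_mul_span_singleton]
    exact Ideal.mul_mono_right ((Ideal.span_singleton_le_iff_mem _).mpr hn)
  · rw [hcharF]
    exact Ideal.mul_mono_right ((Ideal.span_singleton_le_iff_mem _).mpr (hint hsurj))

/-- **Item 19241 `PlusKatoDivisibilityBranch` from THREE NAMED LITERATURE FACTS and the descent frame**
(route-level; the conclusion is the route decl literally). Hypotheses: `h41`, `h22`, `h12` — the named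
facts `Kobayashi2003.thm41_plusEtaCharIdeal_dvd`, `thm22_etaSignedSelmerDual_finite_torsion`,
`thm12_signedSelmerDual_finite_torsion` (hypothesis position); `hdec` — the ∀-form descent frame
(WANTED; displayed). `K₀ := ℚ(ζ_p)`, `η` from `exists_theta_eta_cyclotomicField`. So 19241 is
CITE-LEVEL modulo piece (i). CONDITIONAL; closes nothing.
[cite: Kobayashi2003, Thm. 1.2 (p. 2), Thm. 2.2 (p. 5), Thm. 4.1 (p. 8)]
[cite: GreenbergLNM1716, §1 (p. 60) and §3 (descent in prime-to-p extensions; reading)] -/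
theorem plusKatoDivisibilityBranch_of_namedFacts_of_decomposition
    (h41 : Kobayashi2003.thm41_plusEtaCharIdeal_dvd)
    (h22 : Kobayashi2003.thm22_etaSignedSelmerDual_finite_torsion)
    (h12 : Kobayashi2003.thm12_signedSelmerDual_finite_torsion)
    (hdec : ∀ (p : ℕ) [Fact p.Prime], 5 ≤ p →
      ∀ (K₀ : Type) [Field K₀] [NumberField K₀] [IsCyclotomicExtension {p} ℚ K₀]
        [(galRange (K := ℚ) K₀).Normal] (ηq : absoluteGaloisGroup ℚ →* ℤˣ),
        (∀ σ ∈ galRange (K := ℚ) K₀, ηq σ = 1) → ηq ≠ 1 →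
      ∀ (V : WeierstrassCurve ℚ) [V.IsElliptic] [V.IsGloballyMinimal],
        V.HasGoodReductionAtPrime p → V.frobeniusTrace p = 0 →
      ∀ (κ : ZpExtension ℚ p) (γ : absoluteGaloisGroup ℚ),
        κ.IsCyclotomic → κ.IsTopGenerator γ → γ ∈ galRange (K := ℚ) K₀ →
        IsCyclotomicVariable p γ →
      ∀ (F : Type) [Field F] [NumberField F] (V' : WeierstrassCurve F) [V'.IsElliptic]
        (κF : ZpExtension F p) (γF : absoluteGaloisGroup F),
        Module.finrank ℚ F = 2 → (∃ θ : F, θ ^ 2 = algebraMap ℚ F ((-1) ^ (p / 2) * p)) →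
        (∃ C : VariableChange F, C • V.baseChange F = V') →
        κF.IsCyclotomic → κF.IsTopGenerator γF →
        (∃ ζ : ℤ_[p]ˣ, IsOfFinOrder ζ ∧
          ((GaloisRep.cyclotomicCharacter F p γF * ζ : ℤ_[p]ˣ) : ℤ_[p]) =
            (cyclotomicGenerator p : ℤ_[p])) →
      ∃ Φ : Kobayashi2003.signedSelmerInfty V' κF 1 ≃+
          Kobayashi2003.signedSelmerInfty V κ 1 × towerSignedSelmerInftyEta V κ K₀ ℚ_[p] ηq 1,
        ∀ s : Kobayashi2003.signedSelmerInfty V' κF 1,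
          ((Φ ⟨V'.conjH1 p κF.kerSubgroup γF s,
              Kobayashi2003.conjH1_mem_signedSelmerInfty V' κF 1 γF s.2⟩).1 :
              V.subgroupH1 p κ.kerSubgroup) =
            V.conjH1 p κ.kerSubgroup γ (Φ s).1 ∧
          ((Φ ⟨V'.conjH1 p κF.kerSubgroup γF s,
              Kobayashi2003.conjH1_mem_signedSelmerInfty V' κF 1 γF s.2⟩).2 :
              V.subgroupH1 p (towerTopSubgroup κ K₀)) =
            V.conjH1 p (towerTopSubgroup κ K₀) γ (Φ s).2) :
    PlusKatoDivisibilityBranch := by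
  intro V _ _ p _ hp5 hgood hap
  have hp2 : p ≠ 2 := by omega
  haveI : NeZero p := ⟨(Fact.out : p.Prime).ne_zero⟩
  haveI : IsCyclotomicExtension {p} ℚ (CyclotomicField p ℚ) :=
    CyclotomicField.isCyclotomicExtension p ℚ
  haveI : (galRange (K := ℚ) (CyclotomicField p ℚ)).Normal := normal_galRange_cyclotomic p _
  obtain ⟨θ, ηq, -, -, -, hηK, hη1⟩ := exists_theta_eta_cyclotomicField p hp2
  exact quadraticBranchPlusKatoDivisibilityAt_of_namedFacts_of_decomposition h41 h22 h12
    (CyclotomicField p ℚ) ηq hηK hη1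
    (fun κ γ hκ hγ hγK hγc F _ _ V' _ κF γF hF hθ hC hκF hγF hζ =>
      hdec p hp5 (CyclotomicField p ℚ) ηq hηK hη1 V hgood hap κ γ hκ hγ hγK hγc F V' κF γF hF hθ hC
        hκF hγF hζ)

end Summit.BirchSwinnertonDyer.BirchSwinnertonDyer.Theorems

end
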